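import Literature.NumberTheory.EllipticCurves.SecondKindColmezFunctionalTransport
import Literature.NumberTheory.PAdicHodge.FormalLogFrobeniusSecondKindTransport
import Mathlib.RingTheory.PowerSeries.Expand
import Mathlib.FieldTheory.Finite.Basic
import HarnessLib

/-!
# Evaluation of a transported Hodge line along a division tower: if `G₀ ≡ α·log_{E₀} + β·log_{E₀}(Xᵖ)` modulo a series with
# bounded coefficients, then `pᵐ·G₀(u_m) → α·log_{E₀}(w₀) + β·𝒞_w(log_{E₀}(Xᵖ))` for every sequence `u` that is `δ`-close
# (`δ < 1`) to an exact `[p]_{E₀}`-division tower `w`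

Topic `Literature/NumberTheory/EllipticCurves`; namespace `Literature.NumberTheory.EllipticCurves`. THEOREMS ONLY (no definition, no named
fact, no instance, no `sorry`). Sequel of `SecondKindSeriesValueCocycle` (J1), `SecondKindColmezFunctional` (J2) and
`SecondKindColmezFunctionalTransport` (J3). Setting: `K` complete nontrivially normed ultrametric of characteristic `0` with `‖p‖ < 1`,
`E₀/ℤ` an integral Weierstrass equation, `ℓ = log_{E₀} ∈ K⟦X⟧` (`(E₀.map (Int.castRingHom K)).formalLog`), `ℓ^{(p)} = ℓ(Xᵖ) = expand_p ℓ`,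
values `G(x) := Σ' [Xʲ]G·xʲ` on `𝔪_K`, `[p] = [p]_{E₀}` acting by `evalPt₁`.

* §1 THE TWO GENERATORS OF THE TRANSPORTED FRAME ARE OF THE SECOND KIND FOR `F_{E₀}`: `formalLog_map_cocycle_eq_zero` (`ℓ(F_{E₀}) = ℓ(X₀) + ℓ(X₁)`
  exactly, tree `formalLog_subst_formalGroupLaw`), `exists_nat_norm_coeff_formalLog_map_le_pow` (`‖[Xⁿ]ℓ‖ ≤ n^k`), `expand_subst_eq_subst_pow`
  (`ℓ^{(p)}(a) = ℓ(aᵖ)`), `norm_coeff_expand_le_pow`, `map_frobeniusTwist_int_eq` (`⟨aᵢᵖ⟩ ≡ E₀ (mod p)` over `ℤ`, Fermat), `norm_prime_pow_le_mul_norm_natCast`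
  (`‖p‖ʲ ≤ ‖p‖·‖j‖`), ★ `norm_coeff_expand_formalLog_cocycle_le` — **`‖[X^d](ℓ^{(p)}(F_{E₀}) − ℓ^{(p)}(X₀) − ℓ^{(p)}(X₁))‖ ≤ ‖p‖`**
  (`FormalLogFrobeniusSecondKindTransport.norm_coeff_formalLog_pow_cocycle_le` with `W = E₀`, `c = p`).
* §2 THE TWO FUNCTIONALS: `pow_mul_tsum_formalLog_divisionSeq` (`pⁿ·ℓ(wₙ) = ℓ(w₀)` on an exact tower), `exists_colmez_expand_formalLog`
  (`𝒞_w(ℓ^{(p)}) = lim pⁿℓ^{(p)}(wₙ)` exists with `‖𝒞 − pⁿℓ^{(p)}(wₙ)‖ ≤ ‖p‖ⁿ⁺¹`, and is also `lim pᵐℓ^{(p)}(u_m)` along any `δ`-close `u`).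
* §3 ★★ `tendsto_pow_mul_tsum_of_hodgeLine` — **(HL-eval, limit form)**: if `[Xⁿ](G₀ − α·ℓ − β·ℓ^{(p)})` is bounded then
  `pᵐ·G₀(u_m) → α·ℓ(w₀) + β·𝒞_w(ℓ^{(p)})`; ★★ `tsum_eq_of_hodgeLine_of_pow_mul_tsum_eq` — **(HL-eval)**: if moreover `pᵐ·G₀(u_m) = G₀(u₀)` for all `m`
  (e.g. `G₀ = log_W` along an exact `[p]_W`-tower) then `G₀(u₀) = α·ℓ(w₀) + β·𝒞_w(ℓ^{(p)})`; and the torsion reading `..._eq_zero` (`G₀(u₀) = 0`).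

Purpose (crux K★ `stmt-BirchSwinnertonDyer-22226`, line `kato_lever`, memo `Lines/kato-lever-K2-ramified-cm-transport.md` §9, step J4): with `K = ℂ_F`,
`G₀ = log_{W_D ⊗ ℂ_F}` for the ramified good model `W_D ≡ E₀ (mod ϖ)` of a K★ cell, `(α, β) = (Σ aᵢϖⁱ, Σ bᵢϖⁱ)` from the landed Hodge line
`TransportedHodgeLine.exists_transportedHodgeLine` (bounded defect `p^{−d}`), `u` the Kummer tower of a rational point and `w = Tu` its CM-fibre
transport (`AinfRamifiedDivisionTransport`, `δ = ‖ϖ‖`): **`log_{W_D}(u₀) = α·log_{E₀}(w₀) + β·𝒞_{Tu}(log_{E₀}(Xᵖ))`**, the θ-value of the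
`Fil¹`-combination `α·Λ_{Tu} + β·φΛ_{Tu}` of the transported `A_max`-periods. Infrastructure only; BSD / K★ are not proved by any of this;
nothing about elliptic curves over number fields is proved here.

## References
* N. M. Katz, *Crystalline cohomology, Dieudonné modules, and Jacobi sums* (1981), §5.1, Key Lemma 5.1.3, Thm. 5.1.4 (the Frobenius `f ↦ f(Xᵖ)` on
  `D(G/R)`). [Katz1981CrystallineDieudonne]
* T. Honda, *On the theory of commutative formal groups*, J. Math. Soc. Japan 22 (1970), Lemma 2.3. [Honda1970]
* J. H. Silverman, *The Arithmetic of Elliptic Curves* (2009), IV.2.3, IV.5.2, IV.5.5, Thm. IV.6.4. [SilvermanAEC2009]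
-/

noncomputable section

open scoped Classical Topology
open PowerSeries Filter Finset

namespace Literature.NumberTheory.EllipticCurves

open Literature.NumberTheory.GaloisRepresentations.LubinTate Literature.NumberTheory.PAdicHodge

variable {K : Type*} [NontriviallyNormedField K] [IsUltrametricDist K] [CompleteSpace K] [CharZero K]
  (E₀ : WeierstrassCurve ℤ) {p : ℕ} [hp : Fact p.Prime]

/-! ## §1 `log_{E₀}` and `log_{E₀}(Xᵖ)` are of the second kind for `F_{E₀}` -/

omit [IsUltrametricDist K] [CompleteSpace K] hp in
/-- **`ℓ(F_{E₀}(X₀,X₁)) − ℓ(X₀) − ℓ(X₁) = 0`** for `ℓ = log_{E₀}` read in `K` (the formal logarithm is a homomorphism, AEC IV.5.2).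
[cite: SilvermanAEC2009, IV.5.2] -/
theorem formalLog_map_cocycle_eq_zero :
    (E₀.map (Int.castRingHom K)).formalLog.subst (E₀.map (Int.castRingHom K)).formalGroupLaw -
      (E₀.map (Int.castRingHom K)).formalLog.subst (MvPowerSeries.X 0 : MvPowerSeries (Fin 2) K) -
      (E₀.map (Int.castRingHom K)).formalLog.subst (MvPowerSeries.X 1 : MvPowerSeries (Fin 2) K) = 0 := by
  rw [(E₀.map (Int.castRingHom K)).formalLog_subst_formalGroupLaw, sub_sub, sub_self]

omit [IsUltrametricDist K] [CompleteSpace K] hp in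
/-- The cocycle bound with constant `0` for `ℓ = log_{E₀}` (hypothesis `hC` of J1–J3 with `C = 0`). [cite: SilvermanAEC2009, IV.5.2] -/
theorem norm_coeff_formalLog_map_cocycle_le (d : Fin 2 →₀ ℕ) :
    ‖MvPowerSeries.coeff d ((E₀.map (Int.castRingHom K)).formalLog.subst (E₀.map (Int.castRingHom K)).formalGroupLaw -
      (E₀.map (Int.castRingHom K)).formalLog.subst (MvPowerSeries.X 0 : MvPowerSeries (Fin 2) K) -
      (E₀.map (Int.castRingHom K)).formalLog.subst (MvPowerSeries.X 1 : MvPowerSeries (Fin 2) K))‖ ≤ 0 := by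
  rw [formalLog_map_cocycle_eq_zero, map_zero, norm_zero]

omit [CompleteSpace K] in
/-- **`‖[Xⁿ]log_{E₀}‖ ≤ n^k` for one exponent `k`** (log-type coefficients `c_{n−1}/n`, `c ∈ ℤ`, and `‖n⁻¹‖ ≤ n^k`, tree
`exists_nat_norm_inv_natCast_le_pow`). [cite: SilvermanAEC2009, IV.5.5] -/
theorem exists_nat_norm_coeff_formalLog_map_le_pow (hpK : ‖(p : K)‖ < 1) :
    ∃ k : ℕ, ∀ n : ℕ, ‖PowerSeries.coeff n (E₀.map (Int.castRingHom K)).formalLog‖ ≤ (n : ℝ) ^ k := by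
  obtain ⟨k, hk⟩ := exists_nat_norm_inv_natCast_le_pow (K := K) hpK
  refine ⟨k, fun n => ?_⟩
  rcases Nat.eq_zero_or_pos n with rfl | hn
  · rw [PowerSeries.coeff_zero_eq_constantCoeff, WeierstrassCurve.constantCoeff_formalLog, norm_zero]
    positivity
  · have h1 := norm_natCast_mul_coeff_formalLog_map_le_one (K := K) E₀ n
    have hn0 : (n : K) ≠ 0 := Nat.cast_ne_zero.2 hn.ne'
    calc ‖PowerSeries.coeff n (E₀.map (Int.castRingHom K)).formalLog‖
        = ‖(n : K)⁻¹ * ((n : K) * PowerSeries.coeff n (E₀.map (Int.castRingHom K)).formalLog)‖ := by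
          rw [← mul_assoc, inv_mul_cancel₀ hn0, one_mul]
      _ ≤ ‖(n : K)⁻¹‖ * 1 := by rw [norm_mul]; exact mul_le_mul_of_nonneg_left h1 (norm_nonneg _)
      _ ≤ (n : ℝ) ^ k := by rw [mul_one]; exact hk n

omit [NontriviallyNormedField K] [IsUltrametricDist K] [CompleteSpace K] [CharZero K] in
/-- **`ℓ^{(p)}(a) = ℓ(aᵖ)`**: substituting into `expand_p ℓ = ℓ(Xᵖ)` is substituting the `p`-th power. [cite: Honda1970, Lemma 2.3] -/
theorem expand_subst_eq_subst_pow {L : Type*} [CommRing L] {τ : Type*} (G : PowerSeries L) {a : MvPowerSeries τ L}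
    (ha : MvPowerSeries.constantCoeff a = 0) :
    (PowerSeries.expand p hp.out.ne_zero G).subst a = G.subst (a ^ p) := by
  have haS : PowerSeries.HasSubst a := PowerSeries.HasSubst.of_constantCoeff_zero ha
  rw [PowerSeries.expand_apply, PowerSeries.subst_comp_subst_apply (PowerSeries.HasSubst.X_pow hp.out.ne_zero) haS,
    PowerSeries.subst_pow haS, PowerSeries.subst_X haS]

omit [IsUltrametricDist K] [CompleteSpace K] [CharZero K] in
/-- `expand_p` preserves polynomial coefficient bounds: `‖[Xⁿ]G^{(p)}‖ ≤ n^k` if `‖[Xⁿ]G‖ ≤ n^k` (`[Xⁿ]G^{(p)} = [X^{n/p}]G` or `0`).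
[cite: Honda1970, Lemma 2.3] -/
theorem norm_coeff_expand_le_pow (G : PowerSeries K) {k : ℕ} (hk : ∀ n, ‖PowerSeries.coeff n G‖ ≤ (n : ℝ) ^ k) (n : ℕ) :
    ‖PowerSeries.coeff n (PowerSeries.expand p hp.out.ne_zero G)‖ ≤ (n : ℝ) ^ k := by
  rw [PowerSeries.coeff_expand]
  split_ifs with h
  · obtain ⟨q, rfl⟩ := h
    rw [Nat.mul_div_cancel_left q hp.out.pos]
    refine (hk q).trans (pow_le_pow_left₀ (Nat.cast_nonneg _) ?_ k)
    exact_mod_cast Nat.le_mul_of_pos_left q hp.out.pos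
  · rw [norm_zero]; positivity

omit [IsUltrametricDist K] [CompleteSpace K] [CharZero K] in
/-- `ℓ^{(p)}` has no constant term when `ℓ` has none. [cite: Honda1970, Lemma 2.3] -/
theorem constantCoeff_expand_eq_zero {G : PowerSeries K} (hG : PowerSeries.constantCoeff G = 0) :
    PowerSeries.constantCoeff (PowerSeries.expand p hp.out.ne_zero G) = 0 := by
  rw [PowerSeries.constantCoeff_expand, hG]

/-- **Fermat over `ℤ`: the Frobenius twist `⟨aᵢᵖ⟩` of `E₀` is congruent to `E₀` modulo `p`** (`aᵖ ≡ a (mod p)`), the hypothesis `hW'E` of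
`FormalLogFrobeniusSecondKindTransport.norm_coeff_formalLog_pow_cocycle_le` for `W = E₀` itself. [cite: Katz1981CrystallineDieudonne, Thm. 5.1.4] -/
theorem map_frobeniusTwist_int_eq :
    (⟨E₀.a₁ ^ p, E₀.a₂ ^ p, E₀.a₃ ^ p, E₀.a₄ ^ p, E₀.a₆ ^ p⟩ : WeierstrassCurve ℤ).map (Ideal.Quotient.mk (Ideal.span {((p : ℕ) : ℤ)})) =
      (E₀.map (algebraMap ℤ ℤ)).map (Ideal.Quotient.mk (Ideal.span {((p : ℕ) : ℤ)})) := by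
  have hF : ∀ a : ℤ, Ideal.Quotient.mk (Ideal.span {((p : ℕ) : ℤ)}) (a ^ p) = Ideal.Quotient.mk (Ideal.span {((p : ℕ) : ℤ)}) a := by
    intro a
    refine Ideal.Quotient.eq.2 (Ideal.mem_span_singleton.2 ?_)
    refine (ZMod.intCast_zmod_eq_zero_iff_dvd (a ^ p - a) p).1 ?_
    rw [Int.cast_sub, Int.cast_pow, ZMod.pow_card, sub_self]
  have hid : E₀.map (algebraMap ℤ ℤ) = E₀ := by
    rw [Algebra.algebraMap_self, WeierstrassCurve.map_id]
  rw [hid]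
  ext <;> simp only [WeierstrassCurve.map_a₁, WeierstrassCurve.map_a₂, WeierstrassCurve.map_a₃, WeierstrassCurve.map_a₄,
    WeierstrassCurve.map_a₆, hF]

omit [CompleteSpace K] [CharZero K] in
/-- **`‖p‖ʲ ≤ ‖p‖·‖j‖` for `j ≥ 1`** (`v_p(j) ≤ j − 1`; tree `norm_pow_le_norm_natCast_succ`): the constant `M_p = ‖p‖` of the second-kind
estimates. [cite: SilvermanAEC2009, IV.6.3] -/
theorem norm_prime_pow_le_mul_norm_natCast (hpK : ‖(p : K)‖ < 1) (j : ℕ) (hj : 1 ≤ j) :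
    ‖(p : K)‖ ^ j ≤ ‖(p : K)‖ * ‖(j : K)‖ := by
  obtain ⟨i, rfl⟩ := Nat.exists_eq_add_of_le' hj
  rw [pow_succ']
  exact mul_le_mul_of_nonneg_left (norm_pow_le_norm_natCast_succ hpK i) (norm_nonneg _)

omit [CompleteSpace K] in
/-- ★ **`log_{E₀}(Xᵖ)` is of the second kind for `F_{E₀}` with constant `‖p‖`**: for `ℓ^{(p)} = expand_p log_{E₀}` and every `d`,
`‖[X^d](ℓ^{(p)}(F_{E₀}) − ℓ^{(p)}(X₀) − ℓ^{(p)}(X₁))‖ ≤ ‖p‖` (`F_{E₀}ᵖ ≡ F_{E₀}(X₀ᵖ, X₁ᵖ) (mod p)` by Fermat + Katz's Key Lemma; the tree's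
`norm_coeff_formalLog_pow_cocycle_le` at `W = E₀`, `c = p`, `M_p = M_c = ‖p‖`). [cite: Katz1981CrystallineDieudonne, Key Lemma 5.1.3 and Thm. 5.1.4]
[cite: Honda1970, Lemma 2.3] -/
theorem norm_coeff_expand_formalLog_cocycle_le (hpK : ‖(p : K)‖ < 1) (d : Fin 2 →₀ ℕ) :
    ‖MvPowerSeries.coeff d ((PowerSeries.expand p hp.out.ne_zero (E₀.map (Int.castRingHom K)).formalLog).subst
        (E₀.map (Int.castRingHom K)).formalGroupLaw -
      (PowerSeries.expand p hp.out.ne_zero (E₀.map (Int.castRingHom K)).formalLog).subst (MvPowerSeries.X 0 : MvPowerSeries (Fin 2) K) -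
      (PowerSeries.expand p hp.out.ne_zero (E₀.map (Int.castRingHom K)).formalLog).subst (MvPowerSeries.X 1 : MvPowerSeries (Fin 2) K))‖ ≤
      ‖(p : K)‖ := by
  have hφ : ∀ x : ℤ, ‖Int.castRingHom K x‖ ≤ 1 := fun x => by rw [eq_intCast]; exact IsUltrametricDist.norm_intCast_le_one K x
  have hunit : ¬ IsUnit (((p : ℕ) : ℤ)) := (Nat.prime_iff_prime_int.mp hp.out).not_unit
  have hMp : ∀ j : ℕ, 1 ≤ j → ‖(p : K)‖ ^ j ≤ ‖(p : K)‖ * ‖(j : K)‖ := norm_prime_pow_le_mul_norm_natCast hpK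
  have hMc : ∀ j : ℕ, 1 ≤ j → ‖Int.castRingHom K ((p : ℕ) : ℤ)‖ ^ j ≤ ‖(p : K)‖ * ‖(j : K)‖ := by
    intro j hj; rw [eq_intCast, Int.cast_natCast]; exact hMp j hj
  rw [expand_subst_eq_subst_pow _ (E₀.map (Int.castRingHom K)).constantCoeff_formalGroupLaw,
    expand_subst_eq_subst_pow _ (MvPowerSeries.constantCoeff_X 0), expand_subst_eq_subst_pow _ (MvPowerSeries.constantCoeff_X 1),
    ← WeierstrassCurve.map_formalGroupLaw]
  have h := norm_coeff_formalLog_pow_cocycle_le (Int.castRingHom K) hφ hunit ((p : ℕ) : ℤ) E₀ E₀ (map_frobeniusTwist_int_eq E₀)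
    (norm_nonneg _) (norm_nonneg _) hMp hMc d
  rwa [max_self] at h

/-! ## §2 The two functionals: `pⁿℓ(wₙ) = ℓ(w₀)` and the Colmez functional of `ℓ^{(p)}` -/

/-- **`pⁿ·log_{E₀}(wₙ) = log_{E₀}(w₀)` along an exact `[p]_{E₀}`-division tower** (`C = 0` in J2/J3). [cite: SilvermanAEC2009, IV.6.4] -/
theorem pow_mul_tsum_formalLog_divisionSeq (hpK : ‖(p : K)‖ < 1) (w : ℕ → (ballNilIdeal K).toIdeal)
    (hw : ∀ n, evalPt₁ (ballNilIdeal K) (E₀.formalMul p) (E₀.constantCoeff_formalMul p) (w (n + 1)) = w n) (n : ℕ) :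
    (p : K) ^ n * ∑' j : ℕ, PowerSeries.coeff j (E₀.map (Int.castRingHom K)).formalLog * (((w n : (ballNilIdeal K).toIdeal) : unitBall K) : K) ^ j =
      ∑' j : ℕ, PowerSeries.coeff j (E₀.map (Int.castRingHom K)).formalLog * (((w 0 : (ballNilIdeal K).toIdeal) : unitBall K) : K) ^ j := by
  obtain ⟨k, hk⟩ := exists_nat_norm_coeff_formalLog_map_le_pow E₀ hpK
  exact pow_mul_tsum_divisionSeq_eq_of_cocycle_zero E₀ _ (E₀.map (Int.castRingHom K)).constantCoeff_formalLog k hk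
    (norm_coeff_formalLog_map_cocycle_le E₀) hp.out.one_le w hw n

/-- **The Colmez functional of `ℓ^{(p)} = log_{E₀}(Xᵖ)`** along an exact `[p]_{E₀}`-tower `w` which is `δ`-close (`δ < 1`) to a sequence `u`:
there is `𝒞` with `pⁿ·ℓ^{(p)}(wₙ) → 𝒞`, `pᵐ·ℓ^{(p)}(u_m) → 𝒞` (J3) and `‖𝒞 − pⁿ·ℓ^{(p)}(wₙ)‖ ≤ ‖p‖ⁿ·‖p‖` (J2).
[cite: Katz1981CrystallineDieudonne, Key Lemma 5.1.3, Thm. 5.1.4] -/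
theorem exists_colmez_expand_formalLog (hpK : ‖(p : K)‖ < 1) {δ : ℝ} (hδ : δ < 1) (u w : ℕ → (ballNilIdeal K).toIdeal)
    (hw : ∀ n, evalPt₁ (ballNilIdeal K) (E₀.formalMul p) (E₀.constantCoeff_formalMul p) (w (n + 1)) = w n)
    (huw : ∀ n, ‖(((w n : (ballNilIdeal K).toIdeal) : unitBall K) : K) - (((u n : (ballNilIdeal K).toIdeal) : unitBall K) : K)‖ ≤ δ) :
    ∃ 𝒞 : K,
      Tendsto (fun m : ℕ => (p : K) ^ m * ∑' j : ℕ, PowerSeries.coeff j (PowerSeries.expand p hp.out.ne_zero (E₀.map (Int.castRingHom K)).formalLog) *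
        (((w m : (ballNilIdeal K).toIdeal) : unitBall K) : K) ^ j) atTop (𝓝 𝒞) ∧
      Tendsto (fun m : ℕ => (p : K) ^ m * ∑' j : ℕ, PowerSeries.coeff j (PowerSeries.expand p hp.out.ne_zero (E₀.map (Int.castRingHom K)).formalLog) *
        (((u m : (ballNilIdeal K).toIdeal) : unitBall K) : K) ^ j) atTop (𝓝 𝒞) ∧
      ∀ m : ℕ, ‖𝒞 - (p : K) ^ m * ∑' j : ℕ, PowerSeries.coeff j (PowerSeries.expand p hp.out.ne_zero (E₀.map (Int.castRingHom K)).formalLog) *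
        (((w m : (ballNilIdeal K).toIdeal) : unitBall K) : K) ^ j‖ ≤ ‖(p : K)‖ ^ m * ‖(p : K)‖ := by
  obtain ⟨k, hk⟩ := exists_nat_norm_coeff_formalLog_map_le_pow E₀ hpK
  exact exists_tendsto_pow_mul_tsum_of_divisionSeq_norm_sub_le E₀ _
    (constantCoeff_expand_eq_zero (E₀.map (Int.castRingHom K)).constantCoeff_formalLog) k (norm_coeff_expand_le_pow _ hk) (norm_nonneg _)
    (norm_coeff_expand_formalLog_cocycle_le E₀ hpK) hpK hδ u w hw huw

/-! ## §3 (HL-eval): evaluation of a transported Hodge line along a `δ`-close division tower -/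

omit [IsUltrametricDist K] [CharZero K] in
/-- Summability of `Σ cⱼxʲ` for BOUNDED coefficients `‖cⱼ‖ ≤ B` and `‖x‖ < 1` (geometric comparison). [cite: SilvermanAEC2009, IV.6.4] -/
theorem summable_coeff_mul_pow_of_norm_coeff_le (G : PowerSeries K) {B : ℝ} (hB : ∀ n, ‖PowerSeries.coeff n G‖ ≤ B) {x : K} (hx : ‖x‖ < 1) :
    Summable fun n : ℕ => PowerSeries.coeff n G * x ^ n := by
  have hB0 : 0 ≤ B := (norm_nonneg _).trans (hB 0)
  refine Summable.of_norm_bounded ((summable_geometric_of_lt_one (norm_nonneg x) hx).mul_left B) fun n => ?_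
  rw [norm_mul, norm_pow]
  exact mul_le_mul_of_nonneg_right (hB n) (pow_nonneg (norm_nonneg x) n)

/-- ★★ **(HL-eval, limit form).** Let `ℓ = log_{E₀}`, `ℓ^{(p)} = ℓ(Xᵖ)`, `G₀ ∈ K⟦X⟧`, `α, β ∈ K` with **`‖[Xⁿ](G₀ − α·ℓ − β·ℓ^{(p)})‖ ≤ B`** for all `n`
(a transported Hodge line). Let `w` be an exact `[p]_{E₀}`-division tower and `u` ANY sequence of `𝔪_K` with `‖wₙ − uₙ‖ ≤ δ < 1`. Then, with `𝒞` the Colmez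
functional of `ℓ^{(p)}` along `w`: **`pᵐ·G₀(u_m) → α·ℓ(w₀) + β·𝒞`**. (`G₀(x) = α·ℓ(x) + β·ℓ^{(p)}(x) + h(x)`; J3 transport for `ℓ` and `ℓ^{(p)}`,
and `pᵐh(u_m) → 0` for the bounded defect `h`.) [cite: Katz1981CrystallineDieudonne, §5.1, Thm. 5.1.4] -/
theorem tendsto_pow_mul_tsum_of_hodgeLine (hpK : ‖(p : K)‖ < 1) (G₀ : PowerSeries K) (α β : K) {B : ℝ}
    (hB : ∀ n, ‖PowerSeries.coeff n (G₀ - PowerSeries.C α * (E₀.map (Int.castRingHom K)).formalLog -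
      PowerSeries.C β * PowerSeries.expand p hp.out.ne_zero (E₀.map (Int.castRingHom K)).formalLog)‖ ≤ B)
    {δ : ℝ} (hδ : δ < 1) (u w : ℕ → (ballNilIdeal K).toIdeal)
    (hw : ∀ n, evalPt₁ (ballNilIdeal K) (E₀.formalMul p) (E₀.constantCoeff_formalMul p) (w (n + 1)) = w n)
    (huw : ∀ n, ‖(((w n : (ballNilIdeal K).toIdeal) : unitBall K) : K) - (((u n : (ballNilIdeal K).toIdeal) : unitBall K) : K)‖ ≤ δ) :
    ∃ 𝒞 : K,
      Tendsto (fun m : ℕ => (p : K) ^ m * ∑' j : ℕ, PowerSeries.coeff j (PowerSeries.expand p hp.out.ne_zero (E₀.map (Int.castRingHom K)).formalLog) *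
        (((w m : (ballNilIdeal K).toIdeal) : unitBall K) : K) ^ j) atTop (𝓝 𝒞) ∧
      (∀ m : ℕ, ‖𝒞 - (p : K) ^ m * ∑' j : ℕ, PowerSeries.coeff j (PowerSeries.expand p hp.out.ne_zero (E₀.map (Int.castRingHom K)).formalLog) *
        (((w m : (ballNilIdeal K).toIdeal) : unitBall K) : K) ^ j‖ ≤ ‖(p : K)‖ ^ m * ‖(p : K)‖) ∧
      Tendsto (fun m : ℕ => (p : K) ^ m * ∑' j : ℕ, PowerSeries.coeff j G₀ * (((u m : (ballNilIdeal K).toIdeal) : unitBall K) : K) ^ j) atTop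
        (𝓝 (α * ∑' j : ℕ, PowerSeries.coeff j (E₀.map (Int.castRingHom K)).formalLog * (((w 0 : (ballNilIdeal K).toIdeal) : unitBall K) : K) ^ j +
          β * 𝒞)) := by
  set ℓ := (E₀.map (Int.castRingHom K)).formalLog with hℓ
  set ℓp := PowerSeries.expand p hp.out.ne_zero ℓ with hℓp
  set h := G₀ - PowerSeries.C α * ℓ - PowerSeries.C β * ℓp with hh
  have hB0 : 0 ≤ B := (norm_nonneg _).trans (hB 0)
  obtain ⟨k, hk⟩ := exists_nat_norm_coeff_formalLog_map_le_pow E₀ hpK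
  have hkp : ∀ n, ‖PowerSeries.coeff n ℓp‖ ≤ (n : ℝ) ^ k := norm_coeff_expand_le_pow ℓ hk
  obtain ⟨𝒞, h𝒞w, h𝒞u, hrate⟩ := exists_colmez_expand_formalLog E₀ hpK hδ u w hw huw
  refine ⟨𝒞, h𝒞w, hrate, ?_⟩
  -- `ℓ` along `u`: constant functional `ℓ(w₀)`
  have hℓu : Tendsto (fun m : ℕ => (p : K) ^ m * ∑' j : ℕ, PowerSeries.coeff j ℓ * (((u m : (ballNilIdeal K).toIdeal) : unitBall K) : K) ^ j)
      atTop (𝓝 (∑' j : ℕ, PowerSeries.coeff j ℓ * (((w 0 : (ballNilIdeal K).toIdeal) : unitBall K) : K) ^ j)) := by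
    refine tendsto_pow_mul_tsum_of_divisionSeq_norm_sub_le E₀ ℓ (E₀.map (Int.castRingHom K)).constantCoeff_formalLog k hk le_rfl
      (norm_coeff_formalLog_map_cocycle_le E₀) hpK hδ u w hw huw (tendsto_const_nhds.congr fun m => ?_)
    exact (pow_mul_tsum_formalLog_divisionSeq E₀ hpK w hw m).symm
  -- the bounded defect `h` along `u`: zero functional
  have hhu := tendsto_pow_mul_tsum_zero_of_norm_coeff_le h hB0 hB hpK u
  -- pointwise decomposition of the values of `G₀ = α·ℓ + β·ℓp + h`
  have hdec : ∀ x : (ballNilIdeal K).toIdeal,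
      ∑' j : ℕ, PowerSeries.coeff j G₀ * (((x : unitBall K)) : K) ^ j =
        α * ∑' j : ℕ, PowerSeries.coeff j ℓ * (((x : unitBall K)) : K) ^ j +
          β * ∑' j : ℕ, PowerSeries.coeff j ℓp * (((x : unitBall K)) : K) ^ j +
          ∑' j : ℕ, PowerSeries.coeff j h * (((x : unitBall K)) : K) ^ j := by
    intro x
    have hx : ‖((x : unitBall K) : K)‖ < 1 := norm_lt_one_of_mem x
    have hsℓ := summable_coeff_mul_pow_of_norm_coeff_le_pow ℓ k hk hx
    have hsℓp := summable_coeff_mul_pow_of_norm_coeff_le_pow ℓp k hkp hx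
    have hsh := summable_coeff_mul_pow_of_norm_coeff_le h hB hx
    rw [← tsum_mul_left, ← tsum_mul_left, ← (hsℓ.mul_left α).tsum_add (hsℓp.mul_left β), ← ((hsℓ.mul_left α).add (hsℓp.mul_left β)).tsum_add hsh]
    refine tsum_congr fun j => ?_
    have hG : G₀ = PowerSeries.C α * ℓ + PowerSeries.C β * ℓp + h := by rw [hh]; ring
    rw [hG, map_add, map_add, PowerSeries.coeff_C_mul, PowerSeries.coeff_C_mul]
    ring
  have hsum := ((hℓu.const_mul α).add (h𝒞u.const_mul β)).add hhu
  rw [add_zero] at hsum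
  refine hsum.congr fun m => ?_
  rw [hdec (u m)]
  ring

/-- ★★ **(HL-eval).** In the situation of `tendsto_pow_mul_tsum_of_hodgeLine`, if moreover `pᵐ·G₀(u_m) = G₀(u₀)` for every `m` (e.g. `G₀ = log_W` along an
EXACT `[p]_W`-division tower `u` of a formal group `Ŵ ≡ Ê₀`, `log_W` being an `F_W`-homomorphism), then
**`G₀(u₀) = α·log_{E₀}(w₀) + β·𝒞_w(log_{E₀}(Xᵖ))`** with `𝒞_w` the Colmez functional along the transported tower `w`.
[cite: Katz1981CrystallineDieudonne, §5.1, Thm. 5.1.4] -/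
theorem tsum_eq_of_hodgeLine_of_pow_mul_tsum_eq (hpK : ‖(p : K)‖ < 1) (G₀ : PowerSeries K) (α β : K) {B : ℝ}
    (hB : ∀ n, ‖PowerSeries.coeff n (G₀ - PowerSeries.C α * (E₀.map (Int.castRingHom K)).formalLog -
      PowerSeries.C β * PowerSeries.expand p hp.out.ne_zero (E₀.map (Int.castRingHom K)).formalLog)‖ ≤ B)
    {δ : ℝ} (hδ : δ < 1) (u w : ℕ → (ballNilIdeal K).toIdeal)
    (hw : ∀ n, evalPt₁ (ballNilIdeal K) (E₀.formalMul p) (E₀.constantCoeff_formalMul p) (w (n + 1)) = w n)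
    (huw : ∀ n, ‖(((w n : (ballNilIdeal K).toIdeal) : unitBall K) : K) - (((u n : (ballNilIdeal K).toIdeal) : unitBall K) : K)‖ ≤ δ)
    (hu : ∀ m : ℕ, (p : K) ^ m * ∑' j : ℕ, PowerSeries.coeff j G₀ * (((u m : (ballNilIdeal K).toIdeal) : unitBall K) : K) ^ j =
      ∑' j : ℕ, PowerSeries.coeff j G₀ * (((u 0 : (ballNilIdeal K).toIdeal) : unitBall K) : K) ^ j) :
    ∃ 𝒞 : K,
      Tendsto (fun m : ℕ => (p : K) ^ m * ∑' j : ℕ, PowerSeries.coeff j (PowerSeries.expand p hp.out.ne_zero (E₀.map (Int.castRingHom K)).formalLog) *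
        (((w m : (ballNilIdeal K).toIdeal) : unitBall K) : K) ^ j) atTop (𝓝 𝒞) ∧
      (∀ m : ℕ, ‖𝒞 - (p : K) ^ m * ∑' j : ℕ, PowerSeries.coeff j (PowerSeries.expand p hp.out.ne_zero (E₀.map (Int.castRingHom K)).formalLog) *
        (((w m : (ballNilIdeal K).toIdeal) : unitBall K) : K) ^ j‖ ≤ ‖(p : K)‖ ^ m * ‖(p : K)‖) ∧
      ∑' j : ℕ, PowerSeries.coeff j G₀ * (((u 0 : (ballNilIdeal K).toIdeal) : unitBall K) : K) ^ j =
        α * ∑' j : ℕ, PowerSeries.coeff j (E₀.map (Int.castRingHom K)).formalLog * (((w 0 : (ballNilIdeal K).toIdeal) : unitBall K) : K) ^ j +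
          β * 𝒞 := by
  obtain ⟨𝒞, h𝒞w, hrate, hlim⟩ := tendsto_pow_mul_tsum_of_hodgeLine E₀ hpK G₀ α β hB hδ u w hw huw
  refine ⟨𝒞, h𝒞w, hrate, ?_⟩
  have hconst : Tendsto (fun m : ℕ => (p : K) ^ m * ∑' j : ℕ, PowerSeries.coeff j G₀ * (((u m : (ballNilIdeal K).toIdeal) : unitBall K) : K) ^ j)
      atTop (𝓝 (∑' j : ℕ, PowerSeries.coeff j G₀ * (((u 0 : (ballNilIdeal K).toIdeal) : unitBall K) : K) ^ j)) :=
    tendsto_const_nhds.congr fun m => (hu m).symm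
  exact tendsto_nhds_unique hconst hlim

/-- **(HL-eval) on TORSION towers.** If `pᵐ·G₀(u_m) = 0` for all `m` (e.g. `G₀ = log_W` along a `[p]_W`-division tower of `0`: `u₀ = 0`), then
**`α·log_{E₀}(w₀) + β·𝒞_w(log_{E₀}(Xᵖ)) = 0`** — the `Fil¹`-condition of the transported Hodge combination on the Tate module (note `w₀ = (Tu)₀ ≠ 0`
in general). [cite: Katz1981CrystallineDieudonne, §5.1, Thm. 5.1.4] -/
theorem hodgeLine_eval_eq_zero_of_pow_mul_tsum_eq_zero (hpK : ‖(p : K)‖ < 1) (G₀ : PowerSeries K) (α β : K) {B : ℝ}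
    (hB : ∀ n, ‖PowerSeries.coeff n (G₀ - PowerSeries.C α * (E₀.map (Int.castRingHom K)).formalLog -
      PowerSeries.C β * PowerSeries.expand p hp.out.ne_zero (E₀.map (Int.castRingHom K)).formalLog)‖ ≤ B)
    {δ : ℝ} (hδ : δ < 1) (u w : ℕ → (ballNilIdeal K).toIdeal)
    (hw : ∀ n, evalPt₁ (ballNilIdeal K) (E₀.formalMul p) (E₀.constantCoeff_formalMul p) (w (n + 1)) = w n)
    (huw : ∀ n, ‖(((w n : (ballNilIdeal K).toIdeal) : unitBall K) : K) - (((u n : (ballNilIdeal K).toIdeal) : unitBall K) : K)‖ ≤ δ)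
    (hu : ∀ m : ℕ, (p : K) ^ m * ∑' j : ℕ, PowerSeries.coeff j G₀ * (((u m : (ballNilIdeal K).toIdeal) : unitBall K) : K) ^ j = 0) :
    ∃ 𝒞 : K,
      Tendsto (fun m : ℕ => (p : K) ^ m * ∑' j : ℕ, PowerSeries.coeff j (PowerSeries.expand p hp.out.ne_zero (E₀.map (Int.castRingHom K)).formalLog) *
        (((w m : (ballNilIdeal K).toIdeal) : unitBall K) : K) ^ j) atTop (𝓝 𝒞) ∧
      α * ∑' j : ℕ, PowerSeries.coeff j (E₀.map (Int.castRingHom K)).formalLog * (((w 0 : (ballNilIdeal K).toIdeal) : unitBall K) : K) ^ j +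
          β * 𝒞 = 0 := by
  obtain ⟨𝒞, h𝒞w, -, hlim⟩ := tendsto_pow_mul_tsum_of_hodgeLine E₀ hpK G₀ α β hB hδ u w hw huw
  refine ⟨𝒞, h𝒞w, ?_⟩
  have hconst : Tendsto (fun m : ℕ => (p : K) ^ m * ∑' j : ℕ, PowerSeries.coeff j G₀ * (((u m : (ballNilIdeal K).toIdeal) : unitBall K) : K) ^ j)
      atTop (𝓝 0) :=
    tendsto_const_nhds.congr fun m => (hu m).symm
  exact (tendsto_nhds_unique hlim hconst)

end Literature.NumberTheory.EllipticCurves
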